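import Mathlib.Analysis.Normed.Field.Basic
import Mathlib.Topology.Algebra.Valued.NormedValued
import Mathlib.RingTheory.Valuation.Discrete.IsDiscreteValuationRing
import Mathlib.RingTheory.DedekindDomain.AdicValuation
import HarnessLib

/-!
# The ring of integers of a non-archimedean field, presented by `‖x‖ ≤ 1 ↔ x ∈ R`:
# dictionary between Mathlib's `v`-adic valuation of `R` and the norm of `K`

Topic `Literature/NumberTheory/EllipticCurves/TateCurve`, namespace
`Literature.NumberTheory.EllipticCurves.TateCurve` (abc-iut cell, TRANCHE-T1 P21). Silverman's
Tate-uniformisation statements (ATAEC V.5.3, AEC VII.5.1) speak of "the ring of integers `R` of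
the `p`-adic field `K`", its maximal ideal `𝔐` and the normalised valuation `v`, while Mathlib's
reduction theory for Weierstrass equations (`Mathlib.AlgebraicGeometry.EllipticCurve.Reduction`)
is phrased for an abstract discrete valuation ring `R` with fraction field `K` through
`IsDedekindDomain.HeightOneSpectrum.valuation K (IsDiscreteValuationRing.maximalIdeal R)`, and the
Tate series live in a normed field. The named facts of `TateCurve/Uniformization.lean` therefore
take `R` together with the compatibility hypothesis

  `hR : ∀ x : K, ‖x‖ ≤ 1 ↔ x ∈ Set.range (algebraMap R K)`

("`R` is the closed unit ball"). This file PROVES the resulting dictionary (all elementary;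
Neukirch, *Algebraic Number Theory*, Ch. II (3.8)/(4.?) : the valuation ring `𝒪 = {|x| ≤ 1}`, its
units `𝒪^* = {|x| = 1}` and maximal ideal `𝔭 = {|x| < 1}`):

* `norm_algebraMap_le_one`, `isUnit_iff_norm_eq_one` (`r ∈ R^× ↔ ‖r‖ = 1`),
  `mem_maximalIdeal_iff_norm_lt_one` (`r ∈ 𝔐 ↔ ‖r‖ < 1`);
* `heightOneSpectrum_eq_maximalIdeal` (a DVR has a single nonzero prime);
* `isEquiv_valuation_norm`: the `𝔐`-adic valuation of `K` and `‖·‖` (as Mathlib's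
  `NormedField.valuation`) are EQUIVALENT valuations; hence
  `valuation_le_iff_norm_le`, `valuation_lt_one_iff_norm_lt_one`, `valuation_eq_one_iff_norm_eq_one`.

Used by `TateCurve/UniformizationProofs.lean` (AEC VII.5.1 (b): multiplicative reduction
`⇒ |j| > 1`) and `TateCurve/Reduction.lean` (the Tate equation is a minimal equation with split
multiplicative reduction).

## References
* [NeukirchANT1999] J. Neukirch, *Algebraic Number Theory*, Springer 1999, Ch. II §3
  (Prop. 3.8) and §4 (valuation ring, units, maximal ideal of a valued field).
* [SilvermanAEC2009] J. H. Silverman, *The Arithmetic of Elliptic Curves*, 2nd ed., VII §1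
  (notation `K`, `R`, `𝔐`, `v` for local fields).
-/

noncomputable section

open IsDedekindDomain

namespace Literature.NumberTheory.EllipticCurves.TateCurve

universe u

section Basic

variable {K : Type u} [NormedField K] {R : Type u} [CommRing R] [Algebra R K]

/-- Elements of `R` have norm `≤ 1` (one half of the presentation `‖x‖ ≤ 1 ↔ x ∈ R`).
[cite: NeukirchANT1999, Ch. II Prop. 3.8] -/
theorem norm_algebraMap_le_one (hR : ∀ x : K, ‖x‖ ≤ 1 ↔ x ∈ Set.range (algebraMap R K))
    (r : R) : ‖algebraMap R K r‖ ≤ 1 :=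
  (hR _).mpr ⟨r, rfl⟩

variable [IsFractionRing R K]

/-- **Units of the valuation ring are the elements of norm `1`**: for `r ∈ R`,
`IsUnit r ↔ ‖r‖ = 1` (the inverse in `K` has norm `1 ≤ 1`, hence lies in `R`; `R → K` is
injective). [cite: NeukirchANT1999, Ch. II Prop. 3.8] -/
theorem isUnit_iff_norm_eq_one (hR : ∀ x : K, ‖x‖ ≤ 1 ↔ x ∈ Set.range (algebraMap R K))
    (r : R) : IsUnit r ↔ ‖algebraMap R K r‖ = 1 := by
  have hle : ∀ s : R, ‖algebraMap R K s‖ ≤ 1 := norm_algebraMap_le_one hR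
  constructor
  · rintro ⟨u, rfl⟩
    refine le_antisymm (hle _) (le_of_not_gt fun hlt ↦ ?_)
    have h1 : ‖algebraMap R K (u : R)‖ * ‖algebraMap R K (↑u⁻¹ : R)‖ = 1 := by
      rw [← norm_mul, ← map_mul, Units.mul_inv, map_one, norm_one]
    have : ‖algebraMap R K (u : R)‖ * ‖algebraMap R K (↑u⁻¹ : R)‖ < 1 :=
      mul_lt_one_of_nonneg_of_lt_one_left (norm_nonneg _) hlt (hle _)
    exact absurd h1 this.ne
  · intro h
    have hr0 : algebraMap R K r ≠ 0 := by
      rw [← norm_ne_zero_iff, h]; exact one_ne_zero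
    obtain ⟨s, hs⟩ := (hR (algebraMap R K r)⁻¹).mp (by rw [norm_inv, h, inv_one])
    refine isUnit_iff_exists_inv.mpr ⟨s, IsFractionRing.injective R K ?_⟩
    rw [map_mul, hs, mul_inv_cancel₀ hr0, map_one]

/-- **The maximal ideal is `{‖r‖ < 1}`**: for `r` in a LOCAL ring of integers `R`,
`r ∈ 𝔐 ↔ ‖r‖ < 1` (`𝔐` = non-units; `‖r‖ ≤ 1` always).
[cite: NeukirchANT1999, Ch. II Prop. 3.8] -/
theorem mem_maximalIdeal_iff_norm_lt_one [IsLocalRing R]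
    (hR : ∀ x : K, ‖x‖ ≤ 1 ↔ x ∈ Set.range (algebraMap R K)) (r : R) :
    r ∈ IsLocalRing.maximalIdeal R ↔ ‖algebraMap R K r‖ < 1 := by
  rw [IsLocalRing.mem_maximalIdeal, mem_nonunits_iff, isUnit_iff_norm_eq_one hR,
    (norm_algebraMap_le_one hR r).lt_iff_ne]

end Basic

section Valuation

variable {K : Type u} [NormedField K] [IsUltrametricDist K]
  {R : Type u} [CommRing R] [IsDomain R] [IsDiscreteValuationRing R] [Algebra R K]
  [IsFractionRing R K]

omit [IsUltrametricDist K] in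
/-- A discrete valuation ring has a single nonzero prime: every `HeightOneSpectrum R` is the
maximal ideal (`IsDiscreteValuationRing.maximalIdeal R`). [cite: NeukirchANT1999, Ch. II Prop. 3.8] -/
theorem heightOneSpectrum_eq_maximalIdeal (v : HeightOneSpectrum R) :
    v = IsDiscreteValuationRing.maximalIdeal R := by
  refine HeightOneSpectrum.ext ?_
  change v.asIdeal = IsLocalRing.maximalIdeal R
  exact IsLocalRing.eq_maximalIdeal (v.isPrime.isMaximal v.ne_bot)

omit [IsUltrametricDist K] in
/-- `x ∈ K` has `𝔐`-adic valuation `≤ 1` iff `x ∈ R` (Mathlib's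
`mem_integers_of_valuation_le_one` for the single prime of a DVR).
[cite: NeukirchANT1999, Ch. II Prop. 3.8] -/
theorem valuation_le_one_iff_mem_range (x : K) :
    HeightOneSpectrum.valuation K (IsDiscreteValuationRing.maximalIdeal R) x ≤ 1 ↔
      x ∈ Set.range (algebraMap R K) := by
  constructor
  · intro h
    have hx := HeightOneSpectrum.mem_integers_of_valuation_le_one (R := R) K x fun v ↦ by
      rwa [heightOneSpectrum_eq_maximalIdeal v]
    obtain ⟨r, hr⟩ := hx
    exact ⟨r, hr⟩
  · rintro ⟨r, rfl⟩
    exact HeightOneSpectrum.valuation_le_one _ r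

/-- **The `𝔐`-adic valuation and the norm are equivalent valuations of `K`** (they have the same
valuation ring `R = {‖x‖ ≤ 1}`; Mathlib `Valuation.isEquiv_iff_val_le_one`, the norm as
`NormedField.valuation`). [cite: NeukirchANT1999, Ch. II Prop. 3.8] -/
theorem isEquiv_valuation_norm (hR : ∀ x : K, ‖x‖ ≤ 1 ↔ x ∈ Set.range (algebraMap R K)) :
    (HeightOneSpectrum.valuation K (IsDiscreteValuationRing.maximalIdeal R)).IsEquiv
      (NormedField.valuation (K := K)) := by
  refine Valuation.isEquiv_iff_val_le_one.mpr fun {x} ↦ ?_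
  rw [valuation_le_one_iff_mem_range, ← hR x, NormedField.valuation_apply, ← NNReal.coe_le_coe,
    coe_nnnorm, NNReal.coe_one]

/-- `v(x) ≤ v(y) ↔ ‖x‖ ≤ ‖y‖` for the `𝔐`-adic valuation `v` of `K`.
[cite: NeukirchANT1999, Ch. II Prop. 3.8] -/
theorem valuation_le_iff_norm_le (hR : ∀ x : K, ‖x‖ ≤ 1 ↔ x ∈ Set.range (algebraMap R K))
    (x y : K) :
    HeightOneSpectrum.valuation K (IsDiscreteValuationRing.maximalIdeal R) x ≤
      HeightOneSpectrum.valuation K (IsDiscreteValuationRing.maximalIdeal R) y ↔ ‖x‖ ≤ ‖y‖ := by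
  rw [isEquiv_valuation_norm hR x y, NormedField.valuation_apply, NormedField.valuation_apply,
    ← NNReal.coe_le_coe, coe_nnnorm, coe_nnnorm]

/-- `v(x) < 1 ↔ ‖x‖ < 1` for the `𝔐`-adic valuation `v` of `K`.
[cite: NeukirchANT1999, Ch. II Prop. 3.8] -/
theorem valuation_lt_one_iff_norm_lt_one
    (hR : ∀ x : K, ‖x‖ ≤ 1 ↔ x ∈ Set.range (algebraMap R K)) (x : K) :
    HeightOneSpectrum.valuation K (IsDiscreteValuationRing.maximalIdeal R) x < 1 ↔ ‖x‖ < 1 := by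
  have h := valuation_le_iff_norm_le hR 1 x
  rw [map_one, norm_one] at h
  constructor
  · intro hlt
    exact lt_of_not_ge fun hge ↦ (not_le.mpr hlt) (h.mpr hge)
  · intro hlt
    exact lt_of_not_ge fun hge ↦ (not_le.mpr hlt) (h.mp hge)

/-- `v(x) = 1 ↔ ‖x‖ = 1` for the `𝔐`-adic valuation `v` of `K`.
[cite: NeukirchANT1999, Ch. II Prop. 3.8] -/
theorem valuation_eq_one_iff_norm_eq_one
    (hR : ∀ x : K, ‖x‖ ≤ 1 ↔ x ∈ Set.range (algebraMap R K)) (x : K) :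
    HeightOneSpectrum.valuation K (IsDiscreteValuationRing.maximalIdeal R) x = 1 ↔ ‖x‖ = 1 := by
  have h1 := valuation_le_iff_norm_le hR x 1
  have h2 := valuation_le_iff_norm_le hR 1 x
  rw [map_one, norm_one] at h1 h2
  rw [le_antisymm_iff, le_antisymm_iff, h1, h2]

end Valuation

end Literature.NumberTheory.EllipticCurves.TateCurve

end
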